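/-
# The Kreĭn–Suzuki kernel sampled on a lattice: `LPSD(h)`, its cheap consequences, and the
# two-lattice density criterion

(rh-split cell, seat rh-split-screw-bridge g13, 2026-08-27; kernel scratch for card
`cards/SPLIT-screw-bridge.md` §18.)  Nothing in this file is a claim about the truth of RH.
-/
import Literature.NumberTheory.LFunctions.ZetaScrewThm12Proofs
import Literature.NumberTheory.LFunctions.ZetaScrewThm17Proofs
import Summits.RiemannHypothesis.RiemannHypothesis.Theorems.IntegerScrewScrewDensityDetection
import HarnessLib

/-!
# `LPSD(h)`: positivity of the Kreĭn–Suzuki kernel on the lattice `h ℕ`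

Suzuki's kernel `G(t,u) = Ψ(t) + Ψ(u) - Ψ(t - u)` (`zetaScrewKernel`) is non-negative definite on all of
`ℝ` iff RH (`Suzuki2023_thm12_holds`).  Card §17 split RH as `MaxRe ∧ LAT(h)` with the *diagonal* lattice
conjunct `LAT(h) : ∀ k, 0 ≤ Ψ(k h)`; this file types the natural *kernel* upgrade of the `B`-conjunct,

  `LPSD(h) :  ∀ N (t x : Fin N → ℝ), (∀ i, tᵢ ∈ h ℕ) → 0 ≤ Σᵢⱼ G(tᵢ, tⱼ) xᵢ xⱼ`,

and proves (all RH-free unless RH is a hypothesis):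

* §1 `latticePSD_of_rh` — RH ⟹ `LPSD(h)` for every `h` (Suzuki Thm 1.2 restricted); `latticePos_of_latticePSD` —
  `LPSD(h) ⟹ LAT(h)` (diagonal); `sqrt_le_of_psd₂` / `sqrt_zetaScrew_lattice_le` / `zetaScrew_lattice_le_sq_mul` —
  the `2 × 2` minors of `LPSD(h)` already give the *quadratic ceiling* `Ψ(k h) ≤ k² Ψ(h)` (the square root of a
  negative definite function vanishing at `0` is subadditive: Berg–Christensen–Ressel, *Harmonic analysis on
  semigroups*, Ch. 3 §3 Prop. 3.2, pp. 82–83; cf. p. 109).  So `LPSD(h)` is two-sided: `0 ≤ Ψ(k h) ≤ k² Ψ(h)`.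
* §2 `rh_of_psd_on_two_lattices` / `rh_iff_psd_on_two_lattices` — by contrast, non-negativity of the screw forms on
  configurations drawn from the additive semigroup `ℕ h + ℕ h'` with `h / h'` IRRATIONAL is already EQUIVALENT to RH,
  unconditionally: the augmentation identity `screwForm_eq_cons_shift` moves any configuration in the group
  `ℤ h + ℤ h'` into the semigroup, the group is dense (`AddSubgroup.dense_or_cyclic`), and the forms are continuous
  in the configuration.  (One lattice `h ℕ` is NOT dense, and card §18 exhibits — inside the zero-side model class of
  §17(5) — a configuration with `LPSD(h)`, bounded lattice values and no zero-free strip: barrier candidate B16.)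

Hygiene: no `sorry`, no new axioms, no instances, no notation, nothing `private`.
-/

set_option linter.dupNamespace false

noncomputable section

open Complex Filter Topology Finset

namespace Summit.RiemannHypothesis.RiemannHypothesis.Theorems.Splittings.ScrewLatticePSD

open Literature.NumberTheory.LFunctions
open Literature.Analysis.Complex (IsPosSemidefKernelOn)
open Summit.RiemannHypothesis.RiemannHypothesis.Theorems.IntegerScrew

/-! ## 1. `LPSD(h)` is RH-implied and two-sided -/

/-- RH ⟹ the Kreĭn–Suzuki kernel is non-negative definite on the lattice `{k h : k ∈ ℕ}`
(Suzuki Thm 1.2, restricted). -/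
theorem latticePSD_of_rh (hRH : RiemannHypothesis) (h : ℝ) :
    IsPosSemidefKernelOn (fun t u : ℝ ↦ (zetaScrewKernel t u : ℂ)) (Set.range fun k : ℕ ↦ (k : ℝ) * h) :=
  (Suzuki2023_thm12_holds.1 hRH).mono (Set.subset_univ _)

/-- RH ⟹ the real screw forms are non-negative on lattice configurations. -/
theorem latticeForm_nonneg_of_rh (hRH : RiemannHypothesis) (h : ℝ) :
    ∀ (N : ℕ) (t x : Fin N → ℝ), (∀ i, t i ∈ Set.range fun k : ℕ ↦ (k : ℝ) * h) →
      0 ≤ ∑ i, ∑ j, zetaScrewKernel (t i) (t j) * (x i * x j) :=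
  (isPosSemidefKernelOn_zetaScrewKernel_iff _).1 (latticePSD_of_rh hRH h)

/-- `LPSD(h) ⟹ LAT(h)`: the diagonal of a non-negative definite kernel is non-negative, and
`G(t,t) = 2 Ψ(t)`. -/
theorem latticePos_of_latticePSD {h : ℝ}
    (hpsd : ∀ (N : ℕ) (t x : Fin N → ℝ), (∀ i, t i ∈ Set.range fun k : ℕ ↦ (k : ℝ) * h) →
      0 ≤ ∑ i, ∑ j, zetaScrewKernel (t i) (t j) * (x i * x j)) :
    ∀ k : ℕ, 0 ≤ zetaScrew (k * h) := by
  intro k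
  have h1 := hpsd 1 (fun _ ↦ (k : ℝ) * h) (fun _ ↦ 1) (fun _ ↦ ⟨k, rfl⟩)
  simp only [univ_unique, Fin.default_eq_zero, sum_singleton, zetaScrewKernel_self, mul_one] at h1
  linarith

/-- The `2 × 2` step: if `a, b, c ≥ 0` and the symmetric matrix `[[2a, a+b-c],[a+b-c, 2b]]` is non-negative
definite, then `√a ≤ √b + √c`.  (This is `Ψ(t₁ - t₂) ≥ (√Ψ(t₁) - √Ψ(t₂))²` for the kernel
`G(tᵢ,tⱼ) = Ψ(tᵢ) + Ψ(tⱼ) - Ψ(tᵢ - tⱼ)` on two points.) -/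
theorem sqrt_le_of_psd₂ {a b c : ℝ} (ha : 0 ≤ a) (hb : 0 ≤ b) (hc : 0 ≤ c)
    (hq : ∀ x y : ℝ, 0 ≤ 2 * a * x ^ 2 + 2 * (a + b - c) * (x * y) + 2 * b * y ^ 2) :
    Real.sqrt a ≤ Real.sqrt b + Real.sqrt c := by
  have hsa := Real.sqrt_nonneg a
  have hsb := Real.sqrt_nonneg b
  have hsc := Real.sqrt_nonneg c
  have hsa2 : Real.sqrt a ^ 2 = a := Real.sq_sqrt ha
  have hsb2 : Real.sqrt b ^ 2 = b := Real.sq_sqrt hb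
  have hsc2 : Real.sqrt c ^ 2 = c := Real.sq_sqrt hc
  -- it suffices to show `(√a - √b)² ≤ c`
  suffices hkey : (Real.sqrt a - Real.sqrt b) ^ 2 ≤ c by
    have h1 : (Real.sqrt a - Real.sqrt b) ^ 2 ≤ Real.sqrt c ^ 2 := by rwa [hsc2]
    have h2 : |Real.sqrt a - Real.sqrt b| ≤ |Real.sqrt c| := sq_le_sq.1 h1
    rw [abs_of_nonneg hsc] at h2
    linarith [le_abs_self (Real.sqrt a - Real.sqrt b)]
  -- test vector `(√b, -√a)`
  have h0 := hq (Real.sqrt b) (-Real.sqrt a)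
  have h0' : (a + b - c) * (Real.sqrt a * Real.sqrt b) ≤ 2 * (Real.sqrt a * Real.sqrt b) ^ 2 := by
    have : 2 * a * Real.sqrt b ^ 2 + 2 * (a + b - c) * (Real.sqrt b * -Real.sqrt a) +
        2 * b * (-Real.sqrt a) ^ 2 = 4 * (a * b) - 2 * ((a + b - c) * (Real.sqrt a * Real.sqrt b)) := by
      rw [neg_sq, hsa2, hsb2]; ring
    rw [this] at h0
    have hab : (Real.sqrt a * Real.sqrt b) ^ 2 = a * b := by rw [mul_pow, hsa2, hsb2]
    rw [hab]; linarith
  rcases (mul_nonneg hsa hsb).eq_or_lt with hzero | hpos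
  · -- degenerate case `√a √b = 0`: one of `a`, `b` vanishes
    have hab0 : a = 0 ∨ b = 0 := by
      rcases mul_eq_zero.1 hzero.symm with h | h
      · left
        have h' := hsa2
        rw [h] at h'
        simpa using h'.symm
      · right
        have h' := hsb2
        rw [h] at h'
        simpa using h'.symm
    rcases hab0 with rfl | rfl
    · -- `a = 0`: need `b ≤ c`; test vectors `(-n, 1)`
      rw [Real.sqrt_zero, zero_sub, neg_sq, hsb2]
      by_contra hlt
      push Not at hlt
      have h1 := hq (-((b + 1) / (b - c))) 1
      have hbc : 0 < b - c := by linarith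
      have : 2 * 0 * (-((b + 1) / (b - c))) ^ 2 + 2 * (0 + b - c) * (-((b + 1) / (b - c)) * 1) +
          2 * b * 1 ^ 2 = -2 := by
        field_simp; ring
      linarith
    · -- `b = 0`: need `a ≤ c`; test vectors `(1, -n)`
      rw [Real.sqrt_zero, sub_zero, hsa2]
      by_contra hlt
      push Not at hlt
      have h1 := hq 1 (-((a + 1) / (a - c)))
      have hac : 0 < a - c := by linarith
      have : 2 * a * 1 ^ 2 + 2 * (a + 0 - c) * (1 * -((a + 1) / (a - c))) +
          2 * 0 * (-((a + 1) / (a - c))) ^ 2 = -2 := by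
        field_simp; ring
      linarith
  · have h1 : a + b - c ≤ 2 * (Real.sqrt a * Real.sqrt b) := by
      by_contra hlt
      push Not at hlt
      have := mul_lt_mul_of_pos_right hlt hpos
      linarith [sq (Real.sqrt a * Real.sqrt b)]
    calc (Real.sqrt a - Real.sqrt b) ^ 2 = a + b - 2 * (Real.sqrt a * Real.sqrt b) := by
          rw [sub_sq, hsa2, hsb2]; ring
      _ ≤ c := by linarith

/-- Subadditivity of `√Ψ` along the lattice under `LPSD(h)`: `√Ψ((k+1)h) ≤ √Ψ(k h) + √Ψ(h)`,
hence `√Ψ(k h) ≤ k √Ψ(h)`. -/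
theorem sqrt_zetaScrew_lattice_le {h : ℝ}
    (hpsd : ∀ (N : ℕ) (t x : Fin N → ℝ), (∀ i, t i ∈ Set.range fun k : ℕ ↦ (k : ℝ) * h) →
      0 ≤ ∑ i, ∑ j, zetaScrewKernel (t i) (t j) * (x i * x j)) :
    ∀ k : ℕ, Real.sqrt (zetaScrew (k * h)) ≤ k * Real.sqrt (zetaScrew h) := by
  have hpos := latticePos_of_latticePSD hpsd
  have hh1 : 0 ≤ zetaScrew h := by simpa using hpos 1
  intro k
  induction k with
  | zero => simp [zetaScrew_zero]
  | succ k ih =>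
    -- the `2 × 2` minor on the points `((k+1) h, k h)`
    have hq : ∀ x y : ℝ, 0 ≤ 2 * zetaScrew ((k + 1 : ℕ) * h) * x ^ 2 +
        2 * (zetaScrew ((k + 1 : ℕ) * h) + zetaScrew (k * h) - zetaScrew h) * (x * y) +
        2 * zetaScrew (k * h) * y ^ 2 := by
      intro x y
      have h2 := hpsd 2 ![((k + 1 : ℕ) : ℝ) * h, (k : ℝ) * h] ![x, y] (by
        intro i
        fin_cases i
        · exact ⟨k + 1, rfl⟩
        · exact ⟨k, rfl⟩)
      simp only [Fin.sum_univ_two, Matrix.cons_val_zero, Matrix.cons_val_one,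
        zetaScrewKernel_def] at h2
      have e1 : ((k + 1 : ℕ) : ℝ) * h - (k : ℝ) * h = h := by push_cast; ring
      have e2 : (k : ℝ) * h - ((k + 1 : ℕ) : ℝ) * h = -h := by push_cast; ring
      simp only [e1, e2, zetaScrew_neg, sub_self, zetaScrew_zero] at h2
      have e3 : 2 * zetaScrew ((k + 1 : ℕ) * h) * x ^ 2 +
          2 * (zetaScrew ((k + 1 : ℕ) * h) + zetaScrew (k * h) - zetaScrew h) * (x * y) +
          2 * zetaScrew (k * h) * y ^ 2 =
          (zetaScrew ((k + 1 : ℕ) * h) + zetaScrew ((k + 1 : ℕ) * h) - 0) * (x * x) +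
            (zetaScrew ((k + 1 : ℕ) * h) + zetaScrew (k * h) - zetaScrew h) * (x * y) +
          ((zetaScrew (k * h) + zetaScrew ((k + 1 : ℕ) * h) - zetaScrew h) * (y * x) +
            (zetaScrew (k * h) + zetaScrew (k * h) - 0) * (y * y)) := by ring
      rw [e3]; exact h2
    have hstep := sqrt_le_of_psd₂ (hpos (k + 1)) (hpos k) hh1 hq
    calc Real.sqrt (zetaScrew ((k + 1 : ℕ) * h))
        ≤ Real.sqrt (zetaScrew (k * h)) + Real.sqrt (zetaScrew h) := hstep
      _ ≤ k * Real.sqrt (zetaScrew h) + Real.sqrt (zetaScrew h) := by linarith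
      _ = ((k + 1 : ℕ) : ℝ) * Real.sqrt (zetaScrew h) := by push_cast; ring

/-- **`LPSD(h)` is two-sided on the lattice**: `0 ≤ Ψ(k h) ≤ k² Ψ(h)` for every `k ∈ ℕ`
(the quadratic ceiling of a negative definite sequence; BCR Ch. 3 Prop. 3.2, p. 109). -/
theorem zetaScrew_lattice_le_sq_mul {h : ℝ}
    (hpsd : ∀ (N : ℕ) (t x : Fin N → ℝ), (∀ i, t i ∈ Set.range fun k : ℕ ↦ (k : ℝ) * h) →
      0 ≤ ∑ i, ∑ j, zetaScrewKernel (t i) (t j) * (x i * x j)) (k : ℕ) :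
    0 ≤ zetaScrew (k * h) ∧ zetaScrew (k * h) ≤ (k : ℝ) ^ 2 * zetaScrew h := by
  have hpos := latticePos_of_latticePSD hpsd
  have hh1 : 0 ≤ zetaScrew h := by simpa using hpos 1
  refine ⟨hpos k, ?_⟩
  have h1 := sqrt_zetaScrew_lattice_le hpsd k
  have h2 : Real.sqrt (zetaScrew (k * h)) ^ 2 ≤ ((k : ℝ) * Real.sqrt (zetaScrew h)) ^ 2 :=
    pow_le_pow_left₀ (Real.sqrt_nonneg _) h1 2
  rwa [Real.sq_sqrt (hpos k), mul_pow, Real.sq_sqrt hh1] at h2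

/-- Under RH: the quadratic lattice ceiling `Ψ(k h) ≤ k² Ψ(h)` (unconditional in form: an RH-implied
two-sided lattice statement). -/
theorem zetaScrew_lattice_le_sq_mul_of_rh (hRH : RiemannHypothesis) (h : ℝ) (k : ℕ) :
    zetaScrew (k * h) ≤ (k : ℝ) ^ 2 * zetaScrew h :=
  (zetaScrew_lattice_le_sq_mul (latticeForm_nonneg_of_rh hRH h) k).2

/-! ## 2. Two incommensurable lattices decide RH (density) -/

/-- The group `ℤ h + ℤ h'` is dense in `ℝ` when `h / h'` is irrational (`h' ≠ 0`). -/
theorem dense_intCombinations {h h' : ℝ} (hh' : h' ≠ 0) (hirr : Irrational (h / h')) :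
    Dense {u : ℝ | ∃ a b : ℤ, u = a * h + b * h'} := by
  set S : AddSubgroup ℝ :=
    { carrier := {u : ℝ | ∃ a b : ℤ, u = a * h + b * h'}
      add_mem' := by
        rintro _ _ ⟨a, b, rfl⟩ ⟨a', b', rfl⟩
        exact ⟨a + a', b + b', by push_cast; ring⟩
      zero_mem' := ⟨0, 0, by simp⟩
      neg_mem' := by
        rintro _ ⟨a, b, rfl⟩
        exact ⟨-a, -b, by push_cast; ring⟩ } with hS
  have hmem_h : h ∈ S := ⟨1, 0, by simp⟩
  have hmem_h' : h' ∈ S := ⟨0, 1, by simp⟩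
  rcases AddSubgroup.dense_or_cyclic S with hd | ⟨a, ha⟩
  · exact hd
  · exfalso
    have h1 : h ∈ AddSubgroup.closure ({a} : Set ℝ) := by rw [← ha]; exact hmem_h
    have h2 : h' ∈ AddSubgroup.closure ({a} : Set ℝ) := by rw [← ha]; exact hmem_h'
    obtain ⟨k, hk⟩ := AddSubgroup.mem_closure_singleton.1 h1
    obtain ⟨l, hl⟩ := AddSubgroup.mem_closure_singleton.1 h2
    have hl0 : (l : ℝ) ≠ 0 := by
      rintro hl0
      apply hh'
      rw [← hl, zsmul_eq_mul, hl0, zero_mul]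
    have ha0 : a ≠ 0 := by
      rintro rfl
      apply hh'
      rw [← hl, smul_zero]
    apply hirr
    refine ⟨(k : ℚ) / l, ?_⟩
    rw [Rat.cast_div, Rat.cast_intCast, Rat.cast_intCast, ← hk, ← hl, zsmul_eq_mul, zsmul_eq_mul]
    field_simp

/-- SEMIGROUP ↦ GROUP: non-negativity of the screw forms on configurations in the semigroup
`ℕ h + ℕ h'` gives non-negativity on configurations in the group `ℤ h + ℤ h'` (translate the augmented
zero-sum configuration by `M h + M h'`, `M` large; `screwForm_eq_cons_shift`). -/
theorem screwForm_nonneg_of_natCombinations {h h' : ℝ}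
    (hS : ∀ (N : ℕ) (t x : Fin N → ℝ), (∀ i, t i ∈ {u : ℝ | ∃ j k : ℕ, u = j * h + k * h'}) →
      0 ≤ ∑ i, ∑ j, zetaScrewKernel (t i) (t j) * (x i * x j))
    {N : ℕ} (t x : Fin N → ℝ) (ht : ∀ i, t i ∈ {u : ℝ | ∃ a b : ℤ, u = a * h + b * h'}) :
    0 ≤ ∑ i, ∑ j, zetaScrewKernel (t i) (t j) * (x i * x j) := by
  choose a b hab using ht
  -- a common natural shift `M` with `a i + M ≥ 0`, `b i + M ≥ 0`
  set M : ℕ := ∑ i, ((a i).natAbs + (b i).natAbs) with hM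
  have hle : ∀ i, (a i).natAbs + (b i).natAbs ≤ M := fun i ↦
    Finset.single_le_sum (f := fun j ↦ (a j).natAbs + (b j).natAbs) (fun j _ ↦ Nat.zero_le _)
      (Finset.mem_univ i)
  have hMa : ∀ i, 0 ≤ a i + M := by
    intro i
    have h1 := hle i
    omega
  have hMb : ∀ i, 0 ≤ b i + M := by
    intro i
    have h1 := hle i
    omega
  set L : ℝ := (M : ℝ) * h + (M : ℝ) * h' with hL
  rw [screwForm_eq_cons_shift t x L]
  apply hS
  intro i
  refine Fin.cases ?_ (fun i ↦ ?_) i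
  · exact ⟨M, M, by simp [hL]⟩
  · refine ⟨(a i + M).toNat, (b i + M).toNat, ?_⟩
    simp only [Fin.cons_succ]
    have e1 : (((a i + M).toNat : ℕ) : ℝ) = (a i : ℝ) + M := by
      have := Int.toNat_of_nonneg (hMa i)
      exact_mod_cast this
    have e2 : (((b i + M).toNat : ℕ) : ℝ) = (b i : ℝ) + M := by
      have := Int.toNat_of_nonneg (hMb i)
      exact_mod_cast this
    rw [e1, e2, hab i, hL]
    ring

/-- **TWO INCOMMENSURABLE LATTICES DECIDE RH.**  If `h' ≠ 0`, `h / h'` is irrational, and the screw forms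
are non-negative on all finite configurations drawn from the semigroup `ℕ h + ℕ h'`, then RH holds
(augmentation to the group `ℤ h + ℤ h'`, density of that group, continuity of the forms, Suzuki Thm 1.2). -/
theorem rh_of_psd_on_two_lattices {h h' : ℝ} (hh' : h' ≠ 0) (hirr : Irrational (h / h'))
    (hS : ∀ (N : ℕ) (t x : Fin N → ℝ), (∀ i, t i ∈ {u : ℝ | ∃ j k : ℕ, u = j * h + k * h'}) →
      0 ≤ ∑ i, ∑ j, zetaScrewKernel (t i) (t j) * (x i * x j)) :
    RiemannHypothesis := by
  refine Suzuki2023_thm12_holds.iff_real.2 fun N t x ↦ ?_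
  have hclosed : IsClosed {s : Fin N → ℝ | 0 ≤ ∑ i, ∑ j, zetaScrewKernel (s i) (s j) * (x i * x j)} :=
    isClosed_le continuous_const (continuous_screwForm x)
  have hdense : Dense (Set.pi Set.univ fun _ : Fin N ↦ {u : ℝ | ∃ a b : ℤ, u = a * h + b * h'}) :=
    dense_pi Set.univ fun _ _ ↦ dense_intCombinations hh' hirr
  have hsub : (Set.pi Set.univ fun _ : Fin N ↦ {u : ℝ | ∃ a b : ℤ, u = a * h + b * h'}) ⊆
      {s : Fin N → ℝ | 0 ≤ ∑ i, ∑ j, zetaScrewKernel (s i) (s j) * (x i * x j)} :=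
    fun s hs ↦ screwForm_nonneg_of_natCombinations hS s x fun i ↦ hs i (Set.mem_univ i)
  have hmem : t ∈ closure (Set.pi Set.univ fun _ : Fin N ↦ {u : ℝ | ∃ a b : ℤ, u = a * h + b * h'}) := by
    rw [hdense.closure_eq]; exact Set.mem_univ t
  exact closure_minimal hsub hclosed hmem

/-- **E1 normal form**: for `h' ≠ 0` and `h / h'` irrational,
`RH ⟺` the screw forms are non-negative on all configurations in `ℕ h + ℕ h'`. -/
theorem rh_iff_psd_on_two_lattices {h h' : ℝ} (hh' : h' ≠ 0) (hirr : Irrational (h / h')) :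
    RiemannHypothesis ↔
      ∀ (N : ℕ) (t x : Fin N → ℝ), (∀ i, t i ∈ {u : ℝ | ∃ j k : ℕ, u = j * h + k * h'}) →
        0 ≤ ∑ i, ∑ j, zetaScrewKernel (t i) (t j) * (x i * x j) := by
  refine ⟨fun hRH N t x _ ↦ (Suzuki2023_thm12_holds.iff_real.1 hRH) N t x,
    rh_of_psd_on_two_lattices hh' hirr⟩

/-- The same in the tree's kernel language: `RH ⟺ IsPosSemidefKernelOn G (ℕ h + ℕ h')`. -/
theorem rh_iff_isPosSemidefKernelOn_two_lattices {h h' : ℝ} (hh' : h' ≠ 0) (hirr : Irrational (h / h')) :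
    RiemannHypothesis ↔
      IsPosSemidefKernelOn (fun t u : ℝ ↦ (zetaScrewKernel t u : ℂ))
        {u : ℝ | ∃ j k : ℕ, u = j * h + k * h'} := by
  rw [isPosSemidefKernelOn_zetaScrewKernel_iff, rh_iff_psd_on_two_lattices hh' hirr]

end Summit.RiemannHypothesis.RiemannHypothesis.Theorems.Splittings.ScrewLatticePSD

end
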